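import Summits.ResolutionOfSingularities.ResolutionOfSingularities.Theorems.DeltaCutGradeCertificates3
import HarnessLib

/-!
# MirrorRigidity — decomp-res lens-6 g29 NODE «MirrorCut», kernel part (ii): the RIGIDITY LEMMA

HOME file `decomp-res-lens-6/g29/MirrorRigidity.lean` (companion of `MirrorCut.lean`; imports the landed
`DeltaCutGradeCertificates3` only; namespace `…Theorems.DeltaCutClasses`, NEW section `MRigidity`).

THE CLAIM THE HAND PROOF WOULD CHEAT ON (critic PRICING STATUS :1878 (B3)(ii)), PROVED: over an algebraically closed field
`K` of any characteristic and for any exponent `p ≥ 1`, a subset `S` of the (geometric points of the) top locus `P_t ∪ P_w =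
{z = 0, t·w = 0}` of the mirror datum `D′_p = z^p + u·t^p·w^p` which is stable under the point maps of the three symmetries
of `(D′_p)` certified in `MirrorCut.lean` §A — the mirror `σ̂ : (z,t,u,w) ↦ (z,w,u,t)`, the Frobenius shears `τ̂_c : (z,t,u,w) ↦
(z − c·t·w, t, u + c^p, w)` (every `c`), the scalings `μ̂_λ : (z,t,u,w) ↦ (z, t, λ^{-p}u, λw)` (every `λ ≠ 0`) — and closed in
the `w`-direction along `P_t` (automatic for a zero set: `zeroLocus_wClosed`, `K` infinite) is one of

  `∅`,   `L = {z = t = w = 0}`,   `P_t ∪ P_w`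

(`mirror_rigidity`; for the zero set of an ideal `J ∋ z, t·w` stable under the three algebra maps: `mirror_rigidity_zeroLocus`).
By the Nullstellensatz (`MvPolynomial.vanishingIdeal_zeroLocus_eq_radical`, Mathlib) these are the reduced closed subschemes
`∅`, `L`, `P_t ∪ P_w` of the top locus; `P_t ∪ P_w` is NOT regular along `L` (`Dm_closure_not_prime`, dictionary (R)) and `∅`
is not a centre — so THE ONLY ADMISSIBLE (nonempty, regular, inside the top locus) `Aut(D′_p)`-STABLE CENTRE IS THE CROSSING
LINE `L`, whose blow-up reproduces `D′_p` (`mirrorF_lineChart_t/_w`).  Finite base fields: `L(𝔽_q)` is stable under the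
`𝔽_q`-rational symmetries — a law using it is not compatible with base change (NODE-g29.md §2 (b)); the lemma is stated
over `K = K̄` (geometric points), which is what base-change-compatible laws see.

Elementary (orbits of an explicit group on an explicit set) — [new; elementary] [folklore].
-/


noncomputable section

open CategoryTheory CategoryTheory.Limits AlgebraicGeometry TopologicalSpace IsLocalRing
open Literature.AlgebraicGeometry.Resolution

universe u

namespace Summit.ResolutionOfSingularities.ResolutionOfSingularities.Theorems.DeltaCutClasses

section MRigidity

open MvPolynomial
variable {K : Type*}

/-! #### point sets and point maps (coordinates `0 = z, 1 = t, 2 = u, 3 = w`) -/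

/-- the point `(a, b, c, d)`. DEFINITION (support). -/
def pt4 (a b c d : K) : Fin 4 → K := fun i => if i = 0 then a else if i = 1 then b else if i = 2 then c else d

/-- `pt4_zero`: Auxiliary step of this node's calculus, VERBATIM from the lens file (see the module docstring); the
statement is its type. [folklore] -/
@[simp] theorem pt4_zero (a b c d : K) : pt4 a b c d 0 = a := by simp [pt4]
/-- `pt4_one`: Auxiliary step of this node's calculus, VERBATIM from the lens file (see the module docstring); the
statement is its type. [folklore] -/
@[simp] theorem pt4_one (a b c d : K) : pt4 a b c d 1 = b := by simp [pt4]
/-- `pt4_two`: Auxiliary step of this node's calculus, VERBATIM from the lens file (see the module docstring); the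
statement is its type. [folklore] -/
@[simp] theorem pt4_two (a b c d : K) : pt4 a b c d 2 = c := by simp [pt4]
/-- `pt4_three`: Auxiliary step of this node's calculus, VERBATIM from the lens file (see the module docstring); the
statement is its type. [folklore] -/
@[simp] theorem pt4_three (a b c d : K) : pt4 a b c d 3 = d := by simp [pt4]

/-- every point is `pt4` of its coordinates. [elementary] [folklore] -/
theorem pt4_eta (x : Fin 4 → K) : pt4 (x 0) (x 1) (x 2) (x 3) = x := by
  funext i; fin_cases i <;> simp

variable [Field K]

/-- the geometric points of the plane `P_t = V(z,t)`. DEFINITION (support). -/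
def mirrorPt : Set (Fin 4 → K) := {x | x 0 = 0 ∧ x 1 = 0}

/-- the geometric points of the plane `P_w = V(z,w)`. DEFINITION (support). -/
def mirrorPw : Set (Fin 4 → K) := {x | x 0 = 0 ∧ x 3 = 0}

/-- the geometric points of the crossing line `L = V(z,t,w)`. DEFINITION (support). -/
def mirrorL : Set (Fin 4 → K) := {x | x 0 = 0 ∧ x 1 = 0 ∧ x 3 = 0}

/-- the mirror on points: `σ̂ (z,t,u,w) = (z,w,u,t)`. DEFINITION (support). -/
def swapPt (x : Fin 4 → K) : Fin 4 → K := pt4 (x 0) (x 3) (x 2) (x 1)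

/-- the Frobenius shear on points: `τ̂_c (z,t,u,w) = (z − c·t·w, t, u + c^p, w)`. DEFINITION (support). -/
def shearPt (p : ℕ) (c : K) (x : Fin 4 → K) : Fin 4 → K := pt4 (x 0 - c * x 1 * x 3) (x 1) (x 2 + c ^ p) (x 3)

/-- the scaling on points: `μ̂_λ (z,t,u,w) = (z, t, λ^{-p}·u, λ·w)`. DEFINITION (support). -/
def scaleWPt (p : ℕ) (l : K) (x : Fin 4 → K) : Fin 4 → K := pt4 (x 0) (x 1) ((l⁻¹) ^ p * x 2) (l * x 3)

/-! #### the orbit lemma -/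

/-- **STEP L — the shears act transitively on `L`**: if `S` is `τ̂`-stable and contains a point of `L`, it contains `L`
(`K` algebraically closed: `c^p = b − a` is solvable). [new; elementary] [folklore] -/
theorem mirror_orbit_L [IsAlgClosed K] {p : ℕ} (hp : 0 < p) {S : Set (Fin 4 → K)}
    (hτ : ∀ c : K, ∀ x ∈ S, shearPt p c x ∈ S) {a : K} (ha : pt4 0 0 a 0 ∈ S) (b : K) : pt4 0 0 b 0 ∈ S := by
  obtain ⟨c, hc⟩ := IsAlgClosed.exists_pow_nat_eq (b - a) hp
  have h := hτ c _ ha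
  have e : shearPt p c (pt4 (0 : K) 0 a 0) = pt4 0 0 b 0 := by
    funext i; fin_cases i <;> simp [shearPt, hc]
  rwa [e] at h

/-- **STEP T — shears and scalings act transitively on `P_t ∖ L`**: if `S` is `τ̂`- and `μ̂`-stable and contains a point
`(0,0,a,e)` with `e ≠ 0`, it contains every `(0,0,b,d)` with `d ≠ 0`. [new; elementary] [folklore] -/
theorem mirror_orbit_T [IsAlgClosed K] {p : ℕ} (hp : 0 < p) {S : Set (Fin 4 → K)}
    (hτ : ∀ c : K, ∀ x ∈ S, shearPt p c x ∈ S) (hμ : ∀ l : K, l ≠ 0 → ∀ x ∈ S, scaleWPt p l x ∈ S)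
    {a e : K} (he : e ≠ 0) (hae : pt4 0 0 a e ∈ S) (b d : K) (hd : d ≠ 0) : pt4 0 0 b d ∈ S := by
  set l : K := d / e with hl
  have hl0 : l ≠ 0 := div_ne_zero hd he
  have h1 := hμ l hl0 _ hae
  have e1 : scaleWPt p l (pt4 (0 : K) 0 a e) = pt4 0 0 ((l⁻¹) ^ p * a) d := by
    funext i; fin_cases i <;> simp [scaleWPt, hl, div_mul_cancel₀ d he]
  rw [e1] at h1
  obtain ⟨c, hc⟩ := IsAlgClosed.exists_pow_nat_eq (b - (l⁻¹) ^ p * a) hp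
  have h2 := hτ c _ h1
  have e2 : shearPt p c (pt4 (0 : K) 0 ((l⁻¹) ^ p * a) d) = pt4 0 0 b d := by
    funext i; fin_cases i <;> simp [shearPt, hc]
  rwa [e2] at h2

/-- **THE MIRROR RIGIDITY LEMMA (points).**  `K` algebraically closed, `p ≥ 1`.  A subset `S ⊆ P_t ∪ P_w` stable under `σ̂`,
all `τ̂_c` and all `μ̂_λ` (`λ ≠ 0`), and closed in the `w`-direction along `P_t` (`(0,0,b,d) ∈ S` for all `d ≠ 0` forces
`(0,0,b,0) ∈ S` — automatic for zero sets, `zeroLocus_wClosed`), is `∅`, `L` or `P_t ∪ P_w`. [new; elementary] [folklore] -/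
theorem mirror_rigidity [IsAlgClosed K] {p : ℕ} (hp : 0 < p) (S : Set (Fin 4 → K))
    (hS : S ⊆ mirrorPt ∪ mirrorPw) (hσ : ∀ x ∈ S, swapPt x ∈ S) (hτ : ∀ c : K, ∀ x ∈ S, shearPt p c x ∈ S)
    (hμ : ∀ l : K, l ≠ 0 → ∀ x ∈ S, scaleWPt p l x ∈ S)
    (hcl : ∀ b : K, (∀ d : K, d ≠ 0 → pt4 0 0 b d ∈ S) → pt4 0 0 b 0 ∈ S) :
    S = ∅ ∨ S = mirrorL ∨ S = mirrorPt ∪ mirrorPw := by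
  classical
  rcases S.eq_empty_or_nonempty with h0 | ⟨x₀, hx₀⟩
  · exact Or.inl h0
  right
  by_cases hT : ∃ x ∈ S, ¬ (x 1 = 0 ∧ x 3 = 0)
  · -- a point off L: S = P_t ∪ P_w
    right
    obtain ⟨x, hx, hxL⟩ := hT
    -- produce a point (0,0,a,e) ∈ S with e ≠ 0
    have key : ∃ a e : K, e ≠ 0 ∧ pt4 0 0 a e ∈ S := by
      have hx0 : x 0 = 0 := by
        rcases hS hx with h | h
        · exact h.1
        · exact h.1
      by_cases h1 : x 1 = 0
      · have h3 : x 3 ≠ 0 := fun h3 => hxL ⟨h1, h3⟩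
        refine ⟨x 2, x 3, h3, ?_⟩
        have e : pt4 0 0 (x 2) (x 3) = x := by
          funext i; fin_cases i <;> simp [hx0, h1]
        rwa [e]
      · have h3 : x 3 = 0 := by
          rcases hS hx with h | h
          · exact absurd h.2 h1
          · exact h.2
        refine ⟨x 2, x 1, h1, ?_⟩
        have e : swapPt x = pt4 0 0 (x 2) (x 1) := by
          funext i; fin_cases i <;> simp [swapPt, hx0, h3]
        have := hσ x hx
        rwa [e] at this
    obtain ⟨a, e, he, hae⟩ := key
    have hPt : ∀ b d : K, d ≠ 0 → pt4 0 0 b d ∈ S := fun b d hd => mirror_orbit_T hp hτ hμ he hae b d hd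
    have hL : ∀ b : K, pt4 0 0 b 0 ∈ S := fun b => hcl b (fun d hd => hPt b d hd)
    have hPw : ∀ b d : K, pt4 0 d b 0 ∈ S := by
      intro b d
      by_cases hd : d = 0
      · rw [hd]; exact hL b
      · have e1 : swapPt (pt4 (0 : K) 0 b d) = pt4 0 d b 0 := by
          funext i; fin_cases i <;> simp [swapPt]
        have := hσ _ (hPt b d hd)
        rwa [e1] at this
    refine Set.Subset.antisymm hS ?_
    rintro y (hy | hy)
    · obtain ⟨hy0, hy1⟩ := hy
      by_cases hy3 : y 3 = 0
      · have e1 : pt4 0 0 (y 2) 0 = y := by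
          funext i; fin_cases i <;> simp [hy0, hy1, hy3]
        rw [← e1]; exact hL (y 2)
      · have e1 : pt4 0 0 (y 2) (y 3) = y := by
          funext i; fin_cases i <;> simp [hy0, hy1]
        rw [← e1]; exact hPt (y 2) (y 3) hy3
    · obtain ⟨hy0, hy3⟩ := hy
      have e1 : pt4 0 (y 1) (y 2) 0 = y := by
        funext i; fin_cases i <;> simp [hy0, hy3]
      rw [← e1]; exact hPw (y 2) (y 1)
  · -- every point of S lies on L: S = L
    left
    have hT' : ∀ x ∈ S, x 1 = 0 ∧ x 3 = 0 := fun x hx => by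
      by_contra h
      exact hT ⟨x, hx, h⟩
    refine Set.Subset.antisymm (fun y hy => ?_) ?_
    · have hy0 : y 0 = 0 := by
        rcases hS hy with h | h
        · exact h.1
        · exact h.1
      exact ⟨hy0, hT' y hy⟩
    · have h00 : x₀ 0 = 0 := by
        rcases hS hx₀ with h | h
        · exact h.1
        · exact h.1
      obtain ⟨h01, h03⟩ := hT' x₀ hx₀
      have e0 : pt4 0 0 (x₀ 2) 0 = x₀ := by
        funext i; fin_cases i <;> simp [h00, h01, h03]
      have ha : pt4 0 0 (x₀ 2) 0 ∈ S := by rw [e0]; exact hx₀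
      rintro y ⟨hy0, hy1, hy3⟩
      have e1 : pt4 0 0 (y 2) 0 = y := by
        funext i; fin_cases i <;> simp [hy0, hy1, hy3]
      rw [← e1]
      exact mirror_orbit_L hp hτ ha (y 2)

/-! #### zero sets: closedness in the `w`-direction, stability from algebra maps, the corollary -/

/-- substitution followed by evaluation is evaluation at the substituted point. [elementary] [folklore] -/
theorem aeval_pt_aeval (x : Fin 4 → K) (g : Fin 4 → MvPolynomial (Fin 4) K) (f : MvPolynomial (Fin 4) K) :
    aeval x (aeval g f) = aeval (fun i => aeval x (g i)) f := by
  rw [← AlgHom.comp_apply, MvPolynomial.comp_aeval]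

/-- **stability of a zero set from stability of the ideal**: if `J` is mapped into itself by the substitution `g`, the zero set
of `J` is mapped into itself by the induced point map `x ↦ (g_i(x))_i`. [elementary] [folklore] -/
theorem zeroLocus_stable {J : Ideal (MvPolynomial (Fin 4) K)} {g : Fin 4 → MvPolynomial (Fin 4) K}
    (hJ : ∀ f ∈ J, aeval g f ∈ J) {x : Fin 4 → K} (hx : x ∈ zeroLocus K J) :
    (fun i => aeval x (g i)) ∈ zeroLocus K J := by
  rw [mem_zeroLocus_iff] at hx ⊢
  intro f hf
  rw [← aeval_pt_aeval]
  exact hx _ (hJ f hf)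

/-- **a zero set is closed in the `w`-direction** (`K` infinite): if `(0,0,b,d) ∈ V(J)` for every `d ≠ 0` then `(0,0,b,0) ∈
V(J)` — each `f ∈ J` restricted to the line `{(0,0,b,d)}_d` is a one-variable polynomial with infinitely many roots.
[elementary] [folklore] -/
theorem zeroLocus_wClosed [Infinite K] (J : Ideal (MvPolynomial (Fin 4) K)) (b : K)
    (h : ∀ d : K, d ≠ 0 → pt4 0 0 b d ∈ zeroLocus K J) : pt4 0 0 b 0 ∈ zeroLocus K J := by
  classical
  rw [mem_zeroLocus_iff]
  intro f hf
  -- restrict f to the line d ↦ (0,0,b,d)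
  set φ : Fin 4 → Polynomial K := fun i => if i = 3 then Polynomial.X else Polynomial.C (pt4 (0 : K) 0 b 0 i) with hφ
  set g : Polynomial K := aeval φ f with hg
  have key : ∀ d : K, Polynomial.eval d g = aeval (pt4 (0 : K) 0 b d) f := by
    intro d
    have hcomp : (Polynomial.aeval d).comp (aeval φ) = aeval (pt4 (0 : K) 0 b d) := by
      refine MvPolynomial.algHom_ext (fun i => ?_)
      fin_cases i <;> simp [φ, pt4]
    have := congrArg (fun F : MvPolynomial (Fin 4) K →ₐ[K] K => F f) hcomp
    simp only [AlgHom.comp_apply] at this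
    rw [← this, hg, Polynomial.coe_aeval_eq_eval]
  have hroots : Set.Infinite {d : K | Polynomial.IsRoot g d} := by
    refine ((Set.finite_singleton (0 : K)).infinite_compl).mono ?_
    intro d hd
    have hd' : d ≠ 0 := by simpa using hd
    have := (mem_zeroLocus_iff.1 (h d hd')) f hf
    show Polynomial.IsRoot g d
    rw [Polynomial.IsRoot, key d, this]
  have hg0 : g = 0 := Polynomial.eq_zero_of_infinite_isRoot g hroots
  have := key 0
  rw [hg0, Polynomial.eval_zero] at this
  exact this.symm

/-- **THE MIRROR RIGIDITY LEMMA (zero sets of stable ideals).**  `K` algebraically closed, `p ≥ 1`, `J` an ideal of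
`K[z,t,u,w]` containing `z` and `t·w` (its zero set lies in the top locus `P_t ∪ P_w` of `D′_p`) and mapped into itself by
the mirror `σ`, every Frobenius shear `τ_c` and every scaling `μ_λ` (the symmetries of `(D′_p)`, `MirrorCut.lean` §A).  Then
`V(J)` is `∅`, `L` or `P_t ∪ P_w`.  Read with the Nullstellensatz and dictionary (R): an `Aut(D′_p)`-stable reduced closed
subscheme of the top locus which is nonempty and regular is the crossing line `L`. [new; elementary] [folklore] -/
theorem mirror_rigidity_zeroLocus [IsAlgClosed K] {p : ℕ} (hp : 0 < p) (J : Ideal (MvPolynomial (Fin 4) K))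
    (hz : (X 0 : MvPolynomial (Fin 4) K) ∈ J) (htw : (X 1 * X 3 : MvPolynomial (Fin 4) K) ∈ J)
    (hσ : ∀ f ∈ J, aeval (fun j : Fin 4 => if j = 1 then (X 3 : MvPolynomial (Fin 4) K) else if j = 3 then X 1 else X j) f ∈ J)
    (hτ : ∀ c : K, ∀ f ∈ J, aeval (fun j : Fin 4 => if j = 0 then (X 0 - C c * X 1 * X 3 : MvPolynomial (Fin 4) K)
        else if j = 2 then X 2 + C (c ^ p) else X j) f ∈ J)
    (hμ : ∀ l : K, l ≠ 0 → ∀ f ∈ J, aeval (fun j : Fin 4 => if j = 2 then (C ((l⁻¹) ^ p) * X 2 : MvPolynomial (Fin 4) K)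
        else if j = 3 then C l * X 3 else X j) f ∈ J) :
    zeroLocus K J = ∅ ∨ zeroLocus K J = mirrorL ∨ zeroLocus K J = mirrorPt ∪ mirrorPw := by
  classical
  refine mirror_rigidity hp (zeroLocus K J) ?_ ?_ ?_ ?_ (fun b hb => zeroLocus_wClosed J b hb)
  · intro x hx
    have h0 : x 0 = 0 := by simpa using (mem_zeroLocus_iff.1 hx) _ hz
    have h13 : x 1 * x 3 = 0 := by simpa using (mem_zeroLocus_iff.1 hx) _ htw
    rcases mul_eq_zero.1 h13 with h | h
    · exact Or.inl ⟨h0, h⟩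
    · exact Or.inr ⟨h0, h⟩
  · intro x hx
    have h := zeroLocus_stable hσ hx
    have e : (fun i => aeval x ((fun j : Fin 4 => if j = 1 then (X 3 : MvPolynomial (Fin 4) K)
        else if j = 3 then X 1 else X j) i)) = swapPt x := by
      funext i; fin_cases i <;> simp [swapPt]
    rwa [e] at h
  · intro c x hx
    have h := zeroLocus_stable (hτ c) hx
    have e : (fun i => aeval x ((fun j : Fin 4 => if j = 0 then (X 0 - C c * X 1 * X 3 : MvPolynomial (Fin 4) K)
        else if j = 2 then X 2 + C (c ^ p) else X j) i)) = shearPt p c x := by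
      funext i; fin_cases i <;> simp [shearPt]
    rwa [e] at h
  · intro l hl x hx
    have h := zeroLocus_stable (hμ l hl) hx
    have e : (fun i => aeval x ((fun j : Fin 4 => if j = 2 then (C ((l⁻¹) ^ p) * X 2 : MvPolynomial (Fin 4) K)
        else if j = 3 then C l * X 3 else X j) i)) = scaleWPt p l x := by
      funext i; fin_cases i <;> simp [scaleWPt]
    rwa [e] at h

end MRigidity

end Summit.ResolutionOfSingularities.ResolutionOfSingularities.Theorems.DeltaCutClasses
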